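import Literature.Analysis.Potential.RieszKernelPairingSubordination
import Literature.MathematicalPhysics.QuantumLattice.RandomField
import HarnessLib

/-!
# The Fourier representation of the Riesz pairing on `ℝ³` (Stein, *Singular Integrals*, V §1.1)

Analysis/Potential proof file (everything proved; no definitions, no named facts).  For
`0 < α < 3` and real Schwartz functions `u, v` on `ℝ³`,

  `∫∫ u(x) |x − y|^{-α} v(y) dy dx = c_α · Re ∫ |ξ|^{α−3} û(ξ) conj(v̂(ξ)) dξ`,
  `c_α = π^{α−3/2} Γ((3−α)/2) / Γ(α/2) > 0`,

in Mathlib's convention `û(ξ) = ∫ e^{-2πi⟨x,ξ⟩} u(x) dx` — M. Riesz's composition formula /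
Stein's Lemma 1(b) of Ch. V §1.1 (`(I_α f)^ = (2π|ξ|)^{-α} f̂` tested against `g ∈ 𝒮`), with our
kernel exponent `α` equal to Stein's `n − α`, `n = 3`.  Proof by Gaussian subordination (Stein,
Ch. III §2.1), without distribution theory: `|z|^{-α} = C₁⁻¹ ∫₀^∞ s^{(1−α)/2} G_s(z) ds`
(`integral_Ioi_rpow_mul_heatKernel`, `integral_prod_rieszKernel_eq_integral_Ioi`), the polarised
Gaussian identity `∬ u(x)v(y)G_s(x−y) = Re ∫ e^{-4π²s|ξ|²} û conj(v̂)`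
(`integral_heatSymbol_mul_fourier_mul_conj_fourier`) at each `s`,
`∫₀^∞ s^{(1−α)/2} e^{-4π²s|ξ|²} ds = Γ((3−α)/2)(2π)^{α−3}|ξ|^{α−3}` (`integral_Ioi_rpow_mul_heatSymbol`),
and Fubini in `(s, ξ)` justified by the absolute convergence of `∫ |ξ|^{α−3}|û(ξ)||v̂(ξ)|` (`α > 0`).

* `rieszKernel_fourier_pairing` — the statement above with `∃ c > 0` (the constant is computed in
  the proof as `C₁⁻¹ Γ((3−α)/2) (2π)^{α−3}`, `C₁ = (4π)^{-3/2} 4^{α/2} Γ(α/2)`).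

References: E. M. Stein, *Singular Integrals and Differentiability Properties of Functions*
(1970), Ch. V §1.1 Lemma 1, Ch. III §2.1; M. Riesz, Acta Sci. Math. Szeged 9 (1938);
E. H. Lieb, M. Loss, *Analysis* (2001), Thm. 5.9 and Cor. 5.10.
-/

noncomputable section

open MeasureTheory Set Filter
open scoped FourierTransform ComplexConjugate RealInnerProductSpace Real Topology SchwartzMap
open Literature.Analysis.UnboundedOperators
open Literature.MathematicalPhysics.QuantumManyBody.BoseGas

namespace Literature.Analysis.Potential

/-- Shorthand for `ℝ³`. -/
local notation "E3" => EuclideanSpace ℝ (Fin 3)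

/-! ### Step 2: the spectral side, Fubini in `(s, ξ)` -/

/-- The Fourier transform of a real Schwartz function on `ℝ³` (as a function `ℝ³ → ℂ`) is
integrable and bounded by `‖u‖₁`. [folklore] -/
theorem integrable_fourier_schwartz (u : 𝓢(E3, ℝ)) :
    Integrable (𝓕 (fun x : E3 => (u x : ℂ))) ∧ ∀ ξ : E3, ‖𝓕 (fun x : E3 => (u x : ℂ)) ξ‖ ≤ ∫ x, |u x| := by
  refine ⟨?_, fun ξ => ?_⟩
  · have h := (𝓕 (Literature.MathematicalPhysics.QuantumLattice.ofRealTest u) : 𝓢(E3, ℂ)).integrable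
      (μ := volume)
    exact h.congr (Eventually.of_forall fun ξ => rfl)
  · refine (VectorFourier.norm_fourierIntegral_le_integral_norm _ _ _ _ _).trans (le_of_eq ?_)
    refine integral_congr_ae (Eventually.of_forall fun x => ?_)
    simp only [Complex.norm_real, Real.norm_eq_abs]

/-- For `0 < α` and real Schwartz `u, w` on `ℝ³`, `ξ ↦ |ξ|^{α−3} ‖û(ξ)‖ ‖ŵ(ξ)‖` is integrable
(`|ξ|^{α−3}` is locally integrable, `û` is bounded and integrable). [folklore] -/
theorem integrable_norm_rpow_mul_norm_fourier_mul (u w : 𝓢(E3, ℝ)) {α : ℝ} (h0 : 0 < α) (h3 : α < 3) :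
    Integrable fun ξ : E3 => ‖ξ‖ ^ (α - 3) *
      (‖𝓕 (fun x : E3 => (u x : ℂ)) ξ‖ * ‖𝓕 (fun x : E3 => (w x : ℂ)) ξ‖) := by
  obtain ⟨hUi, hUb⟩ := integrable_fourier_schwartz u
  obtain ⟨-, hWb⟩ := integrable_fourier_schwartz w
  set Mu : ℝ := ∫ x, |u x| with hMu
  set Mw : ℝ := ∫ x, |w x| with hMw
  have hMu0 : 0 ≤ Mu := integral_nonneg fun x => abs_nonneg _
  have hMw0 : 0 ≤ Mw := integral_nonneg fun x => abs_nonneg _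
  have hd : Module.finrank ℝ E3 = 3 := finrank_euclideanSpace_fin
  have hcontU : Continuous (𝓕 (fun x : E3 => (u x : ℂ))) :=
    VectorFourier.fourierIntegral_continuous Real.continuous_fourierChar
      (by exact continuous_inner) u.integrable.ofReal
  have hcontW : Continuous (𝓕 (fun x : E3 => (w x : ℂ))) :=
    VectorFourier.fourierIntegral_continuous Real.continuous_fourierChar
      (by exact continuous_inner) w.integrable.ofReal
  -- dominating function `Mu Mw 𝟙_{|ξ|<1}|ξ|^{α-3} + Mw ‖û(ξ)‖`
  have hj : Integrable ((Metric.ball (0 : E3) 1).indicator fun ξ : E3 => ‖ξ‖ ^ (-(3 - α))) := by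
    rw [integrable_indicator_iff Metric.isOpen_ball.measurableSet]
    refine integrableOn_ball_of_norm_le_rpow (by rw [hd]; norm_num) (C := 1) (α := 3 - α) (r := 1)
      (by rw [hd]; push_cast; linarith) (Eventually.of_forall fun x => ?_)
      ((measurable_norm.pow_const _).aestronglyMeasurable)
    rw [one_mul, Real.norm_eq_abs, abs_of_nonneg (Real.rpow_nonneg (norm_nonneg _) _)]
  have hdom : Integrable fun ξ : E3 =>
      Mu * Mw * (Metric.ball (0 : E3) 1).indicator (fun ξ : E3 => ‖ξ‖ ^ (-(3 - α))) ξ +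
        Mw * ‖𝓕 (fun x : E3 => (u x : ℂ)) ξ‖ := (hj.const_mul _).add (hUi.norm.const_mul _)
  refine hdom.mono' (((measurable_norm.pow_const _).mul
      (hcontU.norm.measurable.mul hcontW.norm.measurable)).aestronglyMeasurable)
    (Eventually.of_forall fun ξ => ?_)
  have hk : 0 ≤ ‖ξ‖ ^ (α - 3) := Real.rpow_nonneg (norm_nonneg _) _
  have hprod : ‖𝓕 (fun x : E3 => (u x : ℂ)) ξ‖ * ‖𝓕 (fun x : E3 => (w x : ℂ)) ξ‖ ≤
      ‖𝓕 (fun x : E3 => (u x : ℂ)) ξ‖ * Mw :=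
    mul_le_mul_of_nonneg_left (hWb ξ) (norm_nonneg _)
  rw [Real.norm_eq_abs, abs_of_nonneg (mul_nonneg hk (mul_nonneg (norm_nonneg _) (norm_nonneg _)))]
  have hexp : -(3 - α) = α - 3 := by ring
  by_cases hξ : ξ ∈ Metric.ball (0 : E3) 1
  · rw [Set.indicator_of_mem hξ, hexp]
    calc ‖ξ‖ ^ (α - 3) * (‖𝓕 (fun x : E3 => (u x : ℂ)) ξ‖ * ‖𝓕 (fun x : E3 => (w x : ℂ)) ξ‖)
        ≤ ‖ξ‖ ^ (α - 3) * (Mu * Mw) :=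
          mul_le_mul_of_nonneg_left (mul_le_mul (hUb ξ) (hWb ξ) (norm_nonneg _) hMu0) hk
      _ = Mu * Mw * ‖ξ‖ ^ (α - 3) := by ring
      _ ≤ Mu * Mw * ‖ξ‖ ^ (α - 3) + Mw * ‖𝓕 (fun x : E3 => (u x : ℂ)) ξ‖ :=
          le_add_of_nonneg_right (mul_nonneg hMw0 (norm_nonneg _))
  · rw [Set.indicator_of_notMem hξ, mul_zero, zero_add]
    rw [Metric.mem_ball, dist_zero_right, not_lt] at hξ
    have hk1 : ‖ξ‖ ^ (α - 3) ≤ 1 := Real.rpow_le_one_of_one_le_of_nonpos hξ (by linarith)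
    calc ‖ξ‖ ^ (α - 3) * (‖𝓕 (fun x : E3 => (u x : ℂ)) ξ‖ * ‖𝓕 (fun x : E3 => (w x : ℂ)) ξ‖)
        ≤ 1 * (‖𝓕 (fun x : E3 => (u x : ℂ)) ξ‖ * Mw) :=
          mul_le_mul hk1 hprod (mul_nonneg (norm_nonneg _) (norm_nonneg _)) zero_le_one
      _ = Mw * ‖𝓕 (fun x : E3 => (u x : ℂ)) ξ‖ := by ring

/-- **Subordination on the spectral side**: for `0 < α < 3` and real Schwartz `u, w` on `ℝ³`,
`∫₀^∞ s^{(1−α)/2} (∫ e^{-4π²s|ξ|²} R(ξ) dξ) ds = Γ((3−α)/2)(2π)^{α−3} ∫ |ξ|^{α−3} R(ξ) dξ`,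
`R = Re(û conj(ŵ))`; Fubini in `(s, ξ)` is justified by the absolute convergence of
`∫ |ξ|^{α−3}|û||ŵ|`. [folklore] -/
theorem integral_Ioi_rpow_mul_integral_heatSymbol (u w : 𝓢(E3, ℝ)) {α : ℝ} (h0 : 0 < α)
    (h3 : α < 3) :
    ∫ s in Ioi (0 : ℝ), s ^ ((1 - α) / 2) * ∫ ξ : E3, heatSymbol s ξ *
        (𝓕 (fun x : E3 => (u x : ℂ)) ξ * conj (𝓕 (fun x : E3 => (w x : ℂ)) ξ)).re =
      Real.Gamma ((3 - α) / 2) * (2 * π) ^ (α - 3) * ∫ ξ : E3, ‖ξ‖ ^ (α - 3) *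
        (𝓕 (fun x : E3 => (u x : ℂ)) ξ * conj (𝓕 (fun x : E3 => (w x : ℂ)) ξ)).re := by
  set R : E3 → ℝ := fun ξ =>
    (𝓕 (fun x : E3 => (u x : ℂ)) ξ * conj (𝓕 (fun x : E3 => (w x : ℂ)) ξ)).re with hR
  have hcontU : Continuous (𝓕 (fun x : E3 => (u x : ℂ))) :=
    VectorFourier.fourierIntegral_continuous Real.continuous_fourierChar
      (by exact continuous_inner) u.integrable.ofReal
  have hcontW : Continuous (𝓕 (fun x : E3 => (w x : ℂ))) :=
    VectorFourier.fourierIntegral_continuous Real.continuous_fourierChar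
      (by exact continuous_inner) w.integrable.ofReal
  have hRc : Continuous R := Complex.continuous_re.comp (hcontU.mul (Complex.continuous_conj.comp hcontW))
  have hRle : ∀ ξ, |R ξ| ≤ ‖𝓕 (fun x : E3 => (u x : ℂ)) ξ‖ * ‖𝓕 (fun x : E3 => (w x : ℂ)) ξ‖ := by
    intro ξ
    refine (Complex.abs_re_le_norm _).trans (le_of_eq ?_)
    rw [norm_mul, Complex.norm_conj]
  set ν : Measure ℝ := volume.restrict (Ioi 0) with hν
  set F : ℝ × E3 → ℝ := fun q => q.1 ^ ((1 - α) / 2) * heatSymbol q.1 q.2 * R q.2 with hF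
  have hsym_m : Measurable fun q : ℝ × E3 => heatSymbol q.1 q.2 := by
    unfold heatSymbol; fun_prop
  have hFm : Measurable F :=
    ((measurable_fst.pow_const _).mul hsym_m).mul (hRc.measurable.comp measurable_snd)
  have hae0 : ∀ᵐ ξ ∂(volume : Measure E3), ξ ≠ 0 := Measure.ae_ne volume 0
  -- integrability of `F` on `(0, ∞) × ℝ³`
  have hFi : Integrable F (ν.prod volume) := by
    rw [integrable_prod_iff' hFm.aestronglyMeasurable]
    constructor
    · filter_upwards [hae0] with ξ hξ
      simp only [hF]
      exact ((integral_Ioi_rpow_mul_heatSymbol h3 hξ).1).mul_const _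
    · have hb := (integrable_norm_rpow_mul_norm_fourier_mul u w h0 h3).const_mul
        (Real.Gamma ((3 - α) / 2) * (2 * π) ^ (α - 3))
      refine hb.mono' ?_ ?_
      · have hGm : AEStronglyMeasurable (fun q : E3 × ℝ => ‖F (q.2, q.1)‖) (volume.prod ν) :=
          ((hFm.comp measurable_swap).norm).aestronglyMeasurable
        exact hGm.integral_prod_right'
      · filter_upwards [hae0] with ξ hξ
        have h1 : ∀ s ∈ Ioi (0 : ℝ), ‖F (s, ξ)‖ = (s ^ ((1 - α) / 2) * heatSymbol s ξ) * |R ξ| := by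
          intro s hs
          have hs0 : 0 < s := hs
          simp only [hF, Real.norm_eq_abs, abs_mul, abs_of_pos (heatSymbol_pos s ξ),
            abs_of_pos (Real.rpow_pos_of_pos hs0 _)]
        rw [Real.norm_eq_abs, abs_of_nonneg (integral_nonneg fun s => norm_nonneg _)]
        change ∫ s in Ioi (0 : ℝ), ‖F (s, ξ)‖ ≤ _
        rw [setIntegral_congr_fun measurableSet_Ioi h1, integral_mul_const,
          (integral_Ioi_rpow_mul_heatSymbol h3 hξ).2]
        have hk : 0 ≤ Real.Gamma ((3 - α) / 2) * (2 * π) ^ (α - 3) * ‖ξ‖ ^ (α - 3) := by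
          have := Real.Gamma_pos_of_pos (by linarith : 0 < (3 - α) / 2)
          positivity
        calc Real.Gamma ((3 - α) / 2) * (2 * π) ^ (α - 3) * ‖ξ‖ ^ (α - 3) * |R ξ|
            ≤ Real.Gamma ((3 - α) / 2) * (2 * π) ^ (α - 3) * ‖ξ‖ ^ (α - 3) *
                (‖𝓕 (fun x : E3 => (u x : ℂ)) ξ‖ * ‖𝓕 (fun x : E3 => (w x : ℂ)) ξ‖) :=
              mul_le_mul_of_nonneg_left (hRle ξ) hk
          _ = _ := by ring
  -- Fubini
  have hswap : ∫ s, ∫ ξ, F (s, ξ) ∂volume ∂ν = ∫ ξ, ∫ s, F (s, ξ) ∂ν ∂volume :=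
    integral_integral_swap (f := fun s ξ => F (s, ξ)) hFi
  have hlhs : ∫ s in Ioi (0 : ℝ), s ^ ((1 - α) / 2) * ∫ ξ : E3, heatSymbol s ξ * R ξ =
      ∫ s, ∫ ξ, F (s, ξ) ∂volume ∂ν := by
    refine integral_congr_ae (Eventually.of_forall fun s => ?_)
    simp only [hF]
    rw [← integral_const_mul]
    refine integral_congr_ae (Eventually.of_forall fun ξ => ?_)
    ring
  have hrhs : ∫ ξ, ∫ s, F (s, ξ) ∂ν ∂volume =
      Real.Gamma ((3 - α) / 2) * (2 * π) ^ (α - 3) * ∫ ξ : E3, ‖ξ‖ ^ (α - 3) * R ξ := by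
    rw [← integral_const_mul]
    refine integral_congr_ae ?_
    filter_upwards [hae0] with ξ hξ
    simp only [hF]
    rw [integral_mul_const, (integral_Ioi_rpow_mul_heatSymbol h3 hξ).2]
    ring
  rw [hlhs, hswap, hrhs]

/-! ### The Fourier representation of the Riesz pairing -/

/-- For `s > 0` and real Schwartz `u, w`, the polarised Gaussian identity in real form:
`∬ u(x) w(y) G_s(x − y) = ∫ e^{-4π²s|ξ|²} Re(û(ξ) conj(ŵ(ξ))) dξ`. [folklore] -/
theorem integral_prod_heatKernel_eq_integral_heatSymbol (u w : 𝓢(E3, ℝ)) {s : ℝ} (hs : 0 < s) :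
    ∫ z : E3 × E3, u z.1 * w z.2 * heatKernel s (z.1 - z.2) ∂(volume.prod volume) =
      ∫ ξ : E3, heatSymbol s ξ *
        (𝓕 (fun x : E3 => (u x : ℂ)) ξ * conj (𝓕 (fun x : E3 => (w x : ℂ)) ξ)).re := by
  have hG := integral_heatSymbol_mul_fourier_mul_conj_fourier u.continuous.measurable
    w.continuous.measurable u.integrable w.integrable hs (V := E3)
  obtain ⟨-, hWb⟩ := integrable_fourier_schwartz w
  have hcontU : Continuous (𝓕 (fun x : E3 => (u x : ℂ))) :=
    VectorFourier.fourierIntegral_continuous Real.continuous_fourierChar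
      (by exact continuous_inner) u.integrable.ofReal
  have hcontW : Continuous (𝓕 (fun x : E3 => (w x : ℂ))) :=
    VectorFourier.fourierIntegral_continuous Real.continuous_fourierChar
      (by exact continuous_inner) w.integrable.ofReal
  obtain ⟨hUi, -⟩ := integrable_fourier_schwartz u
  -- integrability of the complex integrand
  have hint : Integrable fun ξ : E3 => (heatSymbol s ξ : ℂ) *
      (𝓕 (fun x : E3 => (u x : ℂ)) ξ * conj (𝓕 (fun x : E3 => (w x : ℂ)) ξ)) := by
    have h1 : Integrable fun ξ : E3 => 𝓕 (fun x : E3 => (u x : ℂ)) ξ *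
        ((heatSymbol s ξ : ℂ) * conj (𝓕 (fun x : E3 => (w x : ℂ)) ξ)) := by
      refine hUi.mul_bdd (c := 1 * ∫ x, |w x|) ?_ (Eventually.of_forall fun ξ => ?_)
      · exact ((Complex.continuous_ofReal.comp (by unfold heatSymbol; fun_prop :
          Continuous fun ξ : E3 => heatSymbol s ξ)).mul
          (Complex.continuous_conj.comp hcontW)).aestronglyMeasurable
      · rw [norm_mul, Complex.norm_real, Complex.norm_conj, Real.norm_eq_abs,
          abs_of_pos (heatSymbol_pos s ξ)]
        exact mul_le_mul (heatSymbol_le_one hs.le ξ) (hWb ξ) (norm_nonneg _) zero_le_one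
    refine h1.congr (Eventually.of_forall fun ξ => ?_)
    ring
  rw [integral_prod _ (integrable_prod_heatKernel u w hs)]
  have hre := congrArg Complex.re hG
  rw [Complex.ofReal_re] at hre
  rw [← hre, ← integral_complex_re hint]
  refine integral_congr_ae (Eventually.of_forall fun ξ => ?_)
  simp only [Complex.re_ofReal_mul]

/-- **Fourier representation of the Riesz pairing on `ℝ³`** (M. Riesz 1938; Stein, *Singular
Integrals*, Ch. V §1.1, Lemma 1(b), the case `n = 3` with Stein's `α` equal to our `3 − α`, real
Schwartz test functions): for `0 < α < 3` there is `c > 0` (namely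
`c = π^{α−3/2} Γ((3−α)/2)/Γ(α/2)` in Mathlib's normalisation `û(ξ) = ∫ e^{-2πi⟨x,ξ⟩}u`) such that
`∫∫ u(x) |x − y|^{-α} v(y) dy dx = c · Re ∫ |ξ|^{α−3} û(ξ) conj(v̂(ξ)) dξ` for all real Schwartz
`u, v` on `ℝ³`.  Proof by Gaussian subordination and Fubini (module docstring).
[cite: SteinSingularIntegrals1970, Ch. V §1.1 Lemma 1(b), p. 117] -/
theorem rieszKernel_fourier_pairing (α : ℝ) (h0 : 0 < α) (h3 : α < 3) :
    ∃ c : ℝ, 0 < c ∧ ∀ u v : 𝓢(EuclideanSpace ℝ (Fin 3), ℝ),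
      ∫ x, ∫ y, u x * ‖x - y‖ ^ (-α) * v y =
        c * (∫ ξ, (((‖ξ‖ ^ (α - 3) : ℝ)) : ℂ) *
          (𝓕 (fun x => ((u x : ℝ) : ℂ)) ξ * conj (𝓕 (fun x => ((v x : ℝ) : ℂ)) ξ))).re := by
  set C : ℝ := (4 * π) ^ (-(3 / 2 : ℝ)) * (4 : ℝ) ^ (α / 2) * Real.Gamma (α / 2) with hC
  have hCpos : 0 < C := by
    have := Real.Gamma_pos_of_pos (by linarith : 0 < α / 2)
    positivity
  have hc₂ : 0 < Real.Gamma ((3 - α) / 2) * (2 * π) ^ (α - 3) := by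
    have := Real.Gamma_pos_of_pos (by linarith : 0 < (3 - α) / 2)
    positivity
  refine ⟨C⁻¹ * (Real.Gamma ((3 - α) / 2) * (2 * π) ^ (α - 3)), by positivity, fun u v => ?_⟩
  -- left-hand side as an integral over the product
  have hL : ∫ x, ∫ y, u x * ‖x - y‖ ^ (-α) * v y =
      ∫ z : E3 × E3, u z.1 * v z.2 * ‖z.1 - z.2‖ ^ (-α) ∂(volume.prod volume) := by
    rw [integral_prod _ (integrable_prod_rieszKernel u v h0.le h3)]
    refine integral_congr_ae (Eventually.of_forall fun x => integral_congr_ae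
      (Eventually.of_forall fun y => ?_))
    simp only
    ring
  -- right-hand side as a real integral
  obtain ⟨hUi, -⟩ := integrable_fourier_schwartz u
  obtain ⟨-, hVb⟩ := integrable_fourier_schwartz v
  have hcontV : Continuous (𝓕 (fun x : E3 => (v x : ℂ))) :=
    VectorFourier.fourierIntegral_continuous Real.continuous_fourierChar
      (by exact continuous_inner) v.integrable.ofReal
  have hint : Integrable fun ξ : E3 => (((‖ξ‖ ^ (α - 3) : ℝ)) : ℂ) *
      (𝓕 (fun x => ((u x : ℝ) : ℂ)) ξ * conj (𝓕 (fun x => ((v x : ℝ) : ℂ)) ξ)) := by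
    have hb := integrable_norm_rpow_mul_norm_fourier_mul u v h0 h3
    refine hb.mono' ?_ (Eventually.of_forall fun ξ => ?_)
    · exact ((Complex.continuous_ofReal.measurable.comp (measurable_norm.pow_const _)).mul
        ((VectorFourier.fourierIntegral_continuous Real.continuous_fourierChar
          (by exact continuous_inner) u.integrable.ofReal).measurable.mul
          (Complex.continuous_conj.measurable.comp hcontV.measurable))).aestronglyMeasurable
    · rw [norm_mul, norm_mul, Complex.norm_real, Complex.norm_conj, Real.norm_eq_abs,
        abs_of_nonneg (Real.rpow_nonneg (norm_nonneg _) _)]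
  have hR : (∫ ξ, (((‖ξ‖ ^ (α - 3) : ℝ)) : ℂ) *
      (𝓕 (fun x => ((u x : ℝ) : ℂ)) ξ * conj (𝓕 (fun x => ((v x : ℝ) : ℂ)) ξ))).re =
      ∫ ξ : E3, ‖ξ‖ ^ (α - 3) *
        (𝓕 (fun x : E3 => (u x : ℂ)) ξ * conj (𝓕 (fun x : E3 => (v x : ℂ)) ξ)).re := by
    rw [← integral_complex_re hint]
    refine integral_congr_ae (Eventually.of_forall fun ξ => ?_)
    simp only [Complex.re_ofReal_mul]
  rw [hL, hR, integral_prod_rieszKernel_eq_integral_Ioi u v h0 h3, ← hC, mul_assoc,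
    ← integral_Ioi_rpow_mul_integral_heatSymbol u v h0 h3]
  congr 1
  refine setIntegral_congr_fun measurableSet_Ioi fun s hs => ?_
  rw [integral_prod_heatKernel_eq_integral_heatSymbol u v hs]

end Literature.Analysis.Potential

end
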